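import Mathlib
import Literature.Analysis.FluidPDE.KNSSNoAxisymmetricTypeIHolds
import Literature.Analysis.FluidPDE.NSSereginL3BlowupHolds
import Literature.Analysis.FluidPDE.CheskidovShvydkoyRegularProofs
import Literature.Analysis.FunctionSpaces.Complexify
import Literature.Analysis.FunctionSpaces.FourierSobolevNormEmbeddingProofs
import Literature.Barriers.NavierStokesRegularity.SmallDataGlobalRegularityHomSobolev
import Summits.NavierStokesRegularity.NavierStokesRegularity.Theorems.ScenarioCensusForward
import Summits.NavierStokesRegularity.NavierStokesRegularity.Theorems.NavierStokesExistenceSmoothPeriodic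
import Literature.Analysis.FluidPDE.AxisymmetricEuler
import Literature.Analysis.FluidPDE.MillerMiddleEigenvalueCriterionProofs
import Literature.Analysis.FluidPDE.CheskidovShvydkoyHolds
import Literature.Analysis.FluidPDE.CheskidovDaiBootstrap
import Literature.Analysis.FluidPDE.TsaiTopSingularNullHolds
import Literature.Analysis.FluidPDE.GigaMiura2011ScaledAlignmentTypeIHolds
import Literature.Analysis.FluidPDE.Wei2016AprioriHolds
import Literature.Analysis.FluidPDE.GrujicGuberovic2010LocalizedVorticityCriterionHolds
import HarnessLib.Audit
import HarnessLib

/-!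
# Blow-up scenario census — block F, sub-rows F2a, F5′, F6c, F6d, F8, F8a

Second file of block F (the 400-line cap on `ScenarioCensusForward.lean`), keys of `SCENARIO-CENSUS.md`
v1.3 §2 (cell `pub/ns-census`, seat ns-census-lead g2).  Same conventions as the parent file: OPEN rows
are `@[conjecture]` nodes (nothing asserted), EXCLUDED rows are by-name aliases / verbatim statements
with a one-line `row_<key>_excluded`, glue has only registered rows as hypotheses.  **Nothing here is
a claim about Navier–Stokes regularity; no summit statement is proved by this seat.**

| key | cell | value / Lean |
|---|---|---|
| F2a | axisym · Clay + bounded sub-strips · `r‖u‖ ≤ C` on `[0,T)` (KNSS 2009 Thm 6.1) | EXCLUDED — `Row_F2a` (second disjunct of `knss_no_axisymmetric_typeI`) |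
| F5′ | II excluded · axisym with swirl · Clay + bounded sub-strips | OPEN — `Row_F5p`; `row_F5_of_F5p` (with F2: F5′ ⇒ F5) |
| F6c | `‖u(t)‖₃ → ∞` at a first singular time (Seregin 2012) | EXCLUDED — `Row_F6c := seregin_L3_blowup` |
| F6d | Leray–Hopf ∩ `L^q_t L^r_x`, `2/q + 3/r ≤ 1`, `r > 3` (LPS) | EXCLUDED — `Row_F6d := ladyzhenskaya_prodi_serrin` |
| F8 | Clay ∩ `L^∞_t Ḣ^{1/2}_x` (Kenig–Koch 2011 Thm 1; ESS + `Ḣ^{1/2} ⊂ L³`) | EXCLUDED-IN-TREE (derived here: `row_F8_excluded`, from F6c + `eLpNorm_three_le_eHomSobolevSeminorm_half_holds`) |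
| F8a | small `Ḣ^{1/2}` data (perturbative Clay (A)) | EXCLUDED — `Row_F8a` / `BAR….exists_clayA_of_small_homSobolevHalf` |
| F11 | 2½-D datum (independent of `x₃`) on `ℝ³`, rapidly decaying | VACUOUS → EXCLUDED-IN-TREE — `Row_F11` / `row_F11_excluded` (appended; the class is `{0}`) |
| F11t | 2½-D on `𝕋³` (lattice-periodic, `x₃`-invariant data) | PRINT (Ladyzhenskaya 1959; LR Thm 10.1); open in tree — `Row_F11t` (@[conjecture]), `row_F11t_of_clayB` |
| F12 | helical datum (screw-invariant, pitch `h ≠ 0`) on `ℝ³`, rapidly decaying | VACUOUS → EXCLUDED-IN-TREE — `Row_F12` / `row_F12_excluded` (appended; adapted from the census refuter's probe `HelicalVacuity.lean`) |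
-/

noncomputable section

-- the summit and its single problem share the name `NavierStokesRegularity` (D-0017 nested layout)
set_option linter.dupNamespace false

open Set Function Filter Topology MeasureTheory Metric
open scoped NNReal ENNReal ContDiff

namespace Summit.NavierStokesRegularity.NavierStokesRegularity.Theorems.ScenarioCensus

open Literature.Analysis Literature.Analysis.FluidPDE Literature.Analysis.FunctionSpaces
open Literature.Analysis.FunctionSpaces.EuclideanSpace (complexify continuous_complexify)

/-- **Row F2a** (axisymmetric · Clay class, bounded on closed sub-strips · the scale-critical bound
`r ‖u(t,x)‖ ≤ C` on `[0,T) × ℝ³`, `r` = distance to the axis · ANY type): such a solution extends past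
`T` (KNSS 2009 Thm 6.1: "`|u| ≤ C/√(x₁²+x₂²)` ⇒ `|u| ≤ M`"); the second disjunct of
`knss_no_axisymmetric_typeI` (= row F2), PROVED.  EXCLUDED-IN-TREE.
(ref: KochNadirashviliSereginSverak2009, Thm 6.1 (§6, arXiv:0709.3599 p. 11)) -/
def Row_F2a : Prop :=
  ∀ (ν T : ℝ), 0 < ν → 0 < T →
    ∀ (u : ℝ → EuclideanSpace ℝ (Fin 3) → EuclideanSpace ℝ (Fin 3))
      (p : ℝ → EuclideanSpace ℝ (Fin 3) → ℝ),
    IsClassicalNSSolutionOn (Ico 0 T) ν 0 u p → IsLerayHopfOn T ν 0 (u 0) u →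
    (∀ T' < T, ∃ M : ℝ, ∀ t ∈ Icc 0 T', ∀ x, ‖u t x‖ ≤ M) →
    (∀ t ∈ Ico 0 T, IsAxisymmetric (u t)) →
    (∃ C : ℝ, ∀ t ∈ Ico 0 T, ∀ x, cylRadius x * ‖u t x‖ ≤ C) → HasSmoothExtensionPast ν 0 u T

/-- Row F2a is a theorem of the tree (`knss_no_axisymmetric_typeI_holds`, `r‖u‖ ≤ C` disjunct).
[cite: KochNadirashviliSereginSverak2009, Thm 6.1 (arXiv:0709.3599 p. 11)] -/
theorem row_F2a_excluded : Row_F2a := fun _ _ hν hT _ _ h hLH hbdd haxi hC =>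
  knss_no_axisymmetric_typeI_holds hν hT h hLH hbdd haxi (Or.inr hC)

/-- **Row F5′** (Type II excluded · axisymmetric with swirl · Clay class, bounded on closed
sub-strips): a maximal classical Leray–Hopf solution from a rapidly decaying datum with axisymmetric
slices blows up at the Type I rate.  OPEN (by F2 every axisymmetric singularity is Type II, so F5′ is
the whole axisymmetric cell: `row_F5_of_F5p`; Hou's 2022 axisymmetric numerical candidate, if a
singularity, refutes it). [cite: KochNadirashviliSereginSverak2009, §1 (arXiv:0709.3599 p. 4)] -/
@[conjecture] def Row_F5p : Prop :=
  ∀ (ν T : ℝ), 0 < ν → 0 < T →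
    ∀ (u : ℝ → EuclideanSpace ℝ (Fin 3) → EuclideanSpace ℝ (Fin 3))
      (p : ℝ → EuclideanSpace ℝ (Fin 3) → ℝ),
    IsMaximalSmoothSolution ν 0 u p T → IsLerayHopfOn T ν 0 (u 0) u →
    HasRapidSpatialDecay (u 0) → (∀ T' < T, ∃ M : ℝ, ∀ t ∈ Icc 0 T', ∀ x, ‖u t x‖ ≤ M) →
    (∀ t ∈ Ico 0 T, IsAxisymmetric (u t)) → IsTypeIBlowup u T

/-- F2 (proved: no axisymmetric Type I blow-up) and F5′ (no axisymmetric Type II blow-up) give F5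
(no axisymmetric blow-up in the frame). [folklore] -/
theorem row_F5_of_F5p (h : Row_F5p) : Row_F5 := by
  intro ν T hν hT u p hcl hLH hdec hbdd haxi
  by_contra hext
  exact hext (row_F2_excluded hν hT hcl hLH hbdd haxi (Or.inl (h ν T hν hT u p ⟨hcl, hext⟩ hLH hdec hbdd haxi)))

/-- F5 gives F5′ (vacuously). [folklore] -/
theorem row_F5p_of_F5 (h : Row_F5) : Row_F5p :=
  fun ν T hν hT u p hmax hLH hdec hbdd haxi => (hmax.2 (h ν T hν hT u p hmax.1 hLH hdec hbdd haxi)).elim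

/-- **Row F6c** (no symmetry · CLASS `L³` at blow-up): at a first-time singularity of a maximal
finite-energy classical solution, regular in Leray's sense on closed sub-strips, `‖u(t)‖_{L³} → ∞`
(Seregin 2012 Thm 1.1; genuine limit) — ALIAS of `seregin_L3_blowup`, PROVED.  EXCLUDED-IN-TREE.
(ref: Seregin2012, Comm. Math. Phys. 312 Thm. 1.1) -/
def Row_F6c : Prop := seregin_L3_blowup

/-- Row F6c is a theorem of the tree. [cite: Seregin2012, Thm. 1.1] -/
theorem row_F6c_excluded : Row_F6c := seregin_L3_blowup_holds

/-- **Row F6d** (no symmetry · Leray–Hopf ∩ `L^q(0,T; L^r)`, `2/q + 3/r ≤ 1`, `3 < r ≤ ∞`): smooth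
on `(0,T]` (Ladyzhenskaya–Prodi–Serrin) — ALIAS of `ladyzhenskaya_prodi_serrin`, PROVED.
EXCLUDED-IN-TREE. (ref: Prodi1959; Serrin 1963; Robinson–Rodrigo–Sadowski 2016 Thm 8.17) -/
def Row_F6d : Prop := ladyzhenskaya_prodi_serrin

/-- Row F6d is a theorem of the tree. [cite: Prodi1959] -/
theorem row_F6d_excluded : Row_F6d := ladyzhenskaya_prodi_serrin_holds

/-- **Row F8** (no symmetry · Clay class ∩ `L^∞_t Ḣ^{1/2}_x`): a maximal finite-energy classical
solution from its datum, essentially bounded on the closed sub-strips `[0,T'] × ℝ³` (`T' < T`), cannot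
keep the critical Sobolev seminorm `‖u(t)‖_{Ḣ^{1/2}}` (of the complexified slice) bounded on `[0,T)`
— no blow-up inside `L^∞_t Ḣ^{1/2}_x` (Kenig–Koch 2011 Thm 1 for mild solutions; here ESS/Seregin's
`L³` blow-up + the embedding `Ḣ^{1/2}(ℝ³) ⊂ L³(ℝ³)`).  EXCLUDED-IN-TREE (`row_F8_excluded`, derived in
this file). (ref: KenigKoch2011, Thm 1; EscauriazaSereginSverak2003; Seregin2012 Thm 1.1;
BahouriCheminDanchin2011 Thm 1.38) -/
def Row_F8 : Prop :=
  ∀ (ν T : ℝ), 0 < ν → 0 < T →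
    ∀ (u : ℝ → EuclideanSpace ℝ (Fin 3) → EuclideanSpace ℝ (Fin 3))
      (p : ℝ → EuclideanSpace ℝ (Fin 3) → ℝ),
    IsMaximalSmoothSolution ν 0 u p T → IsLerayHopfOn T ν 0 (u 0) u →
    (∀ T' ∈ Ioo 0 T, eLpNorm (uncurry u) ⊤ (volume.restrict (Icc 0 T' ×ˢ univ)) < ⊤) →
    ¬ ∃ A : ℝ≥0, ∀ t ∈ Ico 0 T, Function.eHomSobolevSeminorm (1 / 2 : ℝ) (complexify ∘ u t) ≤ A

/-- Row F8 is a theorem of the tree: `Ḣ^{1/2} ⊂ L³` (`eLpNorm_three_le_eHomSobolevSeminorm_half_holds`)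
turns a uniform `Ḣ^{1/2}` bound into a uniform `L³` bound on `[0,T)`, contradicting Seregin's
`‖u(t)‖₃ → ∞` (`seregin_L3_blowup_holds`, row F6c). [cite: KenigKoch2011, Thm 1] [cite: Seregin2012, Thm. 1.1] -/
theorem row_F8_excluded : Row_F8 := by
  intro ν T hν hT u p hmax hLH hbdd ⟨A, hA⟩
  obtain ⟨C, hC⟩ := eLpNorm_three_le_eHomSobolevSeminorm_half_holds (F := EuclideanSpace ℂ (Fin 3))
  -- uniform `L³` bound on `[0, T)`
  have hL3 : ∀ t ∈ Ico 0 T, eLpNorm (u t) 3 volume ≤ (C * A : ℝ≥0∞) := by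
    intro t ht
    have h2 : MemLp (u t) 2 volume := hLH.memLp t ⟨ht.1, ht.2.le⟩
    have hcont : Continuous (complexify ∘ u t) :=
      continuous_complexify.comp (hmax.1.contDiff_velocity ht).continuous
    have h2c : MemLp (complexify ∘ u t) 2 volume :=
      MemLp.of_le h2 hcont.aestronglyMeasurable
        (Eventually.of_forall fun x => by simp [Function.comp])
    have heq : eLpNorm (u t) 3 volume = eLpNorm (complexify ∘ u t) 3 volume :=
      eLpNorm_congr_norm_ae (Eventually.of_forall fun x => by simp [Function.comp])
    rw [heq]
    exact (hC _ h2c).trans (by gcongr; exact hA t ht)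
  -- `u 0 ∈ L³`
  have h3 : MemLp (u 0) 3 volume :=
    ⟨(hmax.1.contDiff_velocity ⟨le_rfl, hT⟩).continuous.aestronglyMeasurable,
      (hL3 0 ⟨le_rfl, hT⟩).trans_lt (by exact ENNReal.mul_lt_top ENNReal.coe_lt_top ENNReal.coe_lt_top)⟩
  -- Seregin: `‖u(t)‖₃ → ∞`, against the uniform bound
  have hlim := seregin_L3_blowup_holds hν hT hmax hLH h3 hbdd
  have hev : ∀ᶠ t in 𝓝[<] T, ((C * A : ℝ≥0) : ℝ≥0∞) < eLpNorm (u t) 3 volume :=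
    (ENNReal.tendsto_nhds_top_iff_nnreal.1 hlim) (C * A)
  have hin : ∀ᶠ t in 𝓝[<] T, t ∈ Ico 0 T :=
    mem_of_superset (Ioo_mem_nhdsLT hT) fun t ht => ⟨ht.1.le, ht.2⟩
  obtain ⟨t, hlt, ht⟩ := (hev.and hin).exists
  exact (lt_irrefl _) (hlt.trans_le (by simpa using hL3 t ht))

/-- **Row F8a** (no symmetry · SMALL critical data `‖u₀‖_{Ḣ^{1/2}} ≤ δν` · ANY type): Clay (A) holds
for such data (perturbative regime; Fujita–Kato 1964; Lemarié-Rieusset 2016 Thm 7.4 (B)) — the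
statement of the tree theorem `Literature.Barriers.NavierStokesRegularity.exists_clayA_of_small_homSobolevHalf`.
EXCLUDED-IN-TREE. (ref: LemarieRieusset2016, Thm. 7.4 (B)) -/
def Row_F8a : Prop :=
  ∃ δ : ℝ, 0 < δ ∧ ∀ ν : ℝ, 0 < ν →
    ∀ u₀ : EuclideanSpace ℝ (Fin 3) → EuclideanSpace ℝ (Fin 3),
      ContDiff ℝ ∞ u₀ → NSWave0.IsDivFree u₀ → HasRapidSpatialDecay u₀ →
      Function.eHomSobolevSeminorm (1 / 2 : ℝ) (complexify ∘ u₀) ≤ ENNReal.ofReal (δ * ν) →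
      ∃ (u : ℝ → EuclideanSpace ℝ (Fin 3) → EuclideanSpace ℝ (Fin 3))
        (p : ℝ → EuclideanSpace ℝ (Fin 3) → ℝ),
        IsSmoothOnHalfSpace u ∧ IsSmoothOnHalfSpace p ∧ IsNavierStokesSolution ν 0 u₀ u p ∧
          HasBoundedEnergy u

/-- Row F8a is a theorem of the tree. [cite: LemarieRieusset2016, Thm. 7.4 (B)] -/
theorem row_F8a_excluded : Row_F8a :=
  Literature.Barriers.NavierStokesRegularity.exists_clayA_of_small_homSobolevHalf

/-! ## F11 / F12: the planar (2½-D) and helical data classes on `ℝ³` are trivial (appended 2026-08-28)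

A rapidly decaying field that is periodic in a non-zero direction vanishes; `x₃`-independent data are
periodic along `e_z`, and screw-invariant (helical) data are periodic along `2πh e_z` (a full turn is
the identity).  Hence the Clay-(A) cells F11 and F12 contain only `u₀ = 0` — VACUOUS, recorded here
as kernel facts.  The periodicity lemma and the helical corollary are adapted from the census refuter's
probe `pub/ns-census/ns-census-ref/HelicalVacuity.lean` (seat ns-census-ref g2). -/

/-- A rapidly decaying function on `ℝ³` which is periodic with a non-zero period `c` vanishes
identically (iterate the period and use `(1 + ‖x + kc‖) ‖f x‖ ≤ C`). Adapted from the census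
refuter's probe. [folklore] -/
theorem eq_zero_of_periodic_of_hasRapidSpatialDecay {c : EuclideanSpace ℝ (Fin 3)} (hc : c ≠ 0)
    {f : EuclideanSpace ℝ (Fin 3) → EuclideanSpace ℝ (Fin 3)}
    (hper : ∀ x, f (x + c) = f x) (hdec : HasRapidSpatialDecay f) : f = 0 := by
  funext x
  obtain ⟨C, hC⟩ := hdec 0 1
  have hiter : ∀ k : ℕ, f (x + (k : ℝ) • c) = f x := by
    intro k
    induction k with
    | zero => simp
    | succ k ih =>
      have : x + ((k + 1 : ℕ) : ℝ) • c = (x + (k : ℝ) • c) + c := by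
        rw [Nat.cast_succ, add_smul, one_smul, add_assoc]
      rw [this, hper, ih]
  have hbound : ∀ k : ℕ, (1 + ‖x + (k : ℝ) • c‖) * ‖f x‖ ≤ C := by
    intro k
    have h := hC (x + (k : ℝ) • c)
    rw [norm_iteratedFDeriv_zero, hiter k] at h
    simpa [pow_one] using h
  by_contra hne
  have hfx : 0 < ‖f x‖ := norm_pos_iff.2 hne
  have hcpos : 0 < ‖c‖ := norm_pos_iff.2 hc
  obtain ⟨k, hk⟩ := exists_nat_gt ((C / ‖f x‖ + ‖x‖) / ‖c‖)
  have hk' : C / ‖f x‖ + ‖x‖ < (k : ℝ) * ‖c‖ := by rwa [div_lt_iff₀ hcpos] at hk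
  have htri : (k : ℝ) * ‖c‖ - ‖x‖ ≤ ‖x + (k : ℝ) • c‖ := by
    have h1 : ‖(k : ℝ) • c‖ ≤ ‖x + (k : ℝ) • c‖ + ‖x‖ := by
      calc ‖(k : ℝ) • c‖ = ‖(x + (k : ℝ) • c) - x‖ := by rw [add_sub_cancel_left]
        _ ≤ ‖x + (k : ℝ) • c‖ + ‖x‖ := norm_sub_le _ _
    rw [norm_smul, Real.norm_natCast] at h1
    linarith
  have h2 : C / ‖f x‖ < 1 + ‖x + (k : ℝ) • c‖ := by linarith
  have h3 : C < (1 + ‖x + (k : ℝ) • c‖) * ‖f x‖ := by rwa [div_lt_iff₀ hfx] at h2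
  exact absurd (hbound k) (not_le.2 h3)

/-- **Row F11** (2½-D / planar symmetry · `ℝ³` · Clay data): a rapidly decaying datum on `ℝ³` which
is independent of `x₃` (invariant under all translations along `e_z`) is zero — the forward 2½-D cell
of Clay (A) is EMPTY (VACUOUS → EXCLUDED-IN-TREE: `row_F11_excluded`).  The non-vacuous version lives
on `𝕋³` (`Row_F11t`). (folklore) -/
def Row_F11 : Prop :=
  ∀ u₀ : EuclideanSpace ℝ (Fin 3) → EuclideanSpace ℝ (Fin 3),
    HasRapidSpatialDecay u₀ → (∀ (s : ℝ) (x : EuclideanSpace ℝ (Fin 3)), u₀ (x + s • eZ) = u₀ x) →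
    u₀ = 0

/-- Row F11 is a theorem of the tree (periodicity along `e_z` + rapid decay). [folklore] -/
theorem row_F11_excluded : Row_F11 := fun _ hdec hinv =>
  eq_zero_of_periodic_of_hasRapidSpatialDecay (c := eZ) (by simp [eZ]) (fun x => by
    simpa using hinv 1 x) hdec

/-- **Row F11t** (2½-D · `𝕋³` = lattice-periodic data on `ℝ³` invariant under all translations along
`e_z` · ANY type): Clay (B) restricted to such data — smooth global space-periodic solutions exist.
Such flows stay `x₃`-independent: the horizontal part solves 2D Navier–Stokes and `u₃` a linear
advection–diffusion equation, so in print they are globally smooth (Ladyzhenskaya 1959; Majda–Bertozzi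
2002 §2.3; Lemarié-Rieusset 2016 Thm 10.1).  EXCLUDED-IN-PRINT, open in tree (the tree has the 2D
torus theory `fmrt_strong_existence_torus2_holds`, row F10, but not the lift); the `x₃`-invariant
sub-case of the Clay (B) leaf (`row_F11t_of_clayB`). [cite: LemarieRieusset2016, Thm 10.1 (§10.1)] -/
@[conjecture] def Row_F11t : Prop :=
  ∀ ν : ℝ, 0 < ν → ∀ u₀ : EuclideanSpace ℝ (Fin 3) → EuclideanSpace ℝ (Fin 3),
    ContDiff ℝ ∞ u₀ → NSWave0.IsDivFree u₀ → IsLatticePeriodic u₀ →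
    (∀ (s : ℝ) (x : EuclideanSpace ℝ (Fin 3)), u₀ (x + s • eZ) = u₀ x) →
    ∃ (u : ℝ → EuclideanSpace ℝ (Fin 3) → EuclideanSpace ℝ (Fin 3))
      (p : ℝ → EuclideanSpace ℝ (Fin 3) → ℝ),
      IsSmoothOnHalfSpace u ∧ IsSmoothOnHalfSpace p ∧
        IsNavierStokesSolution ν 0 u₀ u p ∧ ∀ t, 0 ≤ t → IsLatticePeriodic (u t)

/-- Row F11t is the `x₃`-invariant sub-case of Clay (B) (leaf `NavierStokesExistenceSmoothPeriodic`).
[folklore] -/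
theorem row_F11t_of_clayB
    (h : Summit.NavierStokesRegularity.NavierStokesRegularity.NavierStokesExistenceSmoothPeriodic) :
    Row_F11t :=
  fun ν hν u₀ hs hdiv hper _ => h ν hν u₀ hs hdiv hper

/-- **Row F12** (helical symmetry · `ℝ³` · Clay data): a rapidly decaying datum on `ℝ³` which is
helically symmetric with pitch `h ≠ 0` — `u₀ (R_θ x + hθ e_z) = R_θ (u₀ x)` for every angle `θ`
(`R_θ = rotZ θ`) — is zero: a full turn `θ = 2π` is the translation by `2πh e_z`, so `u₀` is periodic in
a non-zero direction.  Hence the forward helical cell of Clay (A) is EMPTY (VACUOUS → EXCLUDED-IN-TREE: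
`row_F12_excluded`); helical flows live on `ℝ² × 𝕋` / helical pipes (Mahalov–Titi–Leibovich 1990;
Lemarié-Rieusset 2016 Thm 10.7 — outside Clay (A)/(B), no tree predicate).  Adapted from the census
refuter's probe `HelicalVacuity.lean`. (folklore; ref: MahalovTitiLeibovich1990; LemarieRieusset2016 Thm 10.7) -/
def Row_F12 : Prop :=
  ∀ (u₀ : EuclideanSpace ℝ (Fin 3) → EuclideanSpace ℝ (Fin 3)) (h : ℝ), h ≠ 0 →
    HasRapidSpatialDecay u₀ →
    (∀ (θ : ℝ) (x : EuclideanSpace ℝ (Fin 3)), u₀ (rotZ θ x + (h * θ) • eZ) = rotZ θ (u₀ x)) →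
    u₀ = 0

/-- Row F12 is a theorem of the tree (`R_{2π} = id`, periodicity along `2πh e_z`, rapid decay).
[folklore] -/
theorem row_F12_excluded : Row_F12 := by
  intro u₀ h hh hdec hhel
  have h2pi : ∀ x : EuclideanSpace ℝ (Fin 3), rotZ (2 * Real.pi) x = x := fun x => by
    ext i; fin_cases i <;> simp [rotZ]
  have hper : ∀ x, u₀ (x + (h * (2 * Real.pi)) • eZ) = u₀ x := fun x => by
    simpa [h2pi] using hhel (2 * Real.pi) x
  have hc : (h * (2 * Real.pi)) • eZ ≠ 0 := by
    have hne : h * (2 * Real.pi) ≠ 0 := mul_ne_zero hh (by positivity)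
    intro h0
    have := congrArg (fun w : EuclideanSpace ℝ (Fin 3) => w 2) h0
    simp [eZ, hne] at this
  exact eq_zero_of_periodic_of_hasRapidSpatialDecay hc hper hdec

/-! ## Rows F6f and by-name additions F1bS, F5bW, F9t, F18eV (appended 2026-08-28; census v1.12,
ref H18/H19) — Literature facts BY NAME, route-independent -/

/-- **Row F6f** (I∨II · none · strain-spectral / intermittency criteria in the census or Leray–Hopf
frame): (a) Miller 2019 — a majorant `m ≥ λ₂⁺(∇_sym u)` of the middle eigenvalue of the strain in
`L^p_t L^q_x`, `2/p + 3/q = 2`, `3/2 < q < ∞` ⇒ extension past `T`; (b) Cheskidov–Shvydkoy 2010 —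
dyadic `Ḃ^{-1}_{∞,∞}` smallness ⇒ `H¹`-regular up to `T`; (c) Cheskidov–Dai — the occupation /
intermittency criterion ⇒ `H¹`-regular up to `T`.  ALIAS of the conjunction of the three typed facts,
all PROVED.  EXCLUDED-IN-TREE (criteria). (ref: Miller2019; CheskidovShvydkoy2010, Lemma 3.2;
CheskidovDai, Thm 1.1 — see the facts' docstrings) -/
def Row_F6f : Prop :=
  Miller2019.middleEigenvalueCriterion ∧ cheskidov_shvydkoy_dyadic_regular ∧ cheskidov_dai_occupation_regular

/-- Row F6f is a theorem of the tree (three discharges). [folklore] -/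
theorem row_F6f_excluded : Row_F6f :=
  ⟨Miller2019.middleEigenvalueCriterion_holds, cheskidov_shvydkoy_dyadic_regular_holds,
    cheskidov_dai_occupation_regular_holds⟩

/-- **Row F1bS** (Type I · Giga–Miura's SCALED continuous-alignment condition (CA′) ⇒ no Type-I
blow-up; by-name addition to row F1b) — ALIAS of `gigaMiura2011_scaledAlignment_typeI`, PROVED.
EXCLUDED-IN-TREE (criterion). (ref: GigaMiura2011, Thm 1.1 with Rmk 1.4) -/
def Row_F1bS : Prop := gigaMiura2011_scaledAlignment_typeI

/-- Row F1bS is a theorem of the tree. [cite: GigaMiura2011, Thm 1.1 with Rmk 1.4] -/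
theorem row_F1bS_excluded : Row_F1bS := gigaMiura2011_scaledAlignment_typeI_holds

/-- **Row F5bW** (axisymmetric · Wei 2016's log-modulus-of-swirl criterion in its printed form;
by-name addition to row F5b, whose conjunct `LeiZhang2017_logModulus_regularity` is the Lei–Zhang
rendering) — ALIAS of `Wei2016_logModulus_regularity`, PROVED.  EXCLUDED-IN-TREE (criterion).
(ref: Wei2016; LeiZhang2017) -/
def Row_F5bW : Prop := Wei2016_logModulus_regularity

/-- Row F5bW is a theorem of the tree. [folklore] -/
theorem row_F5bW_excluded : Row_F5bW := Wei2016_logModulus_regularity_holds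

/-- **Row F9t** (suitable weak solutions · the singular set at the TOP of a parabolic cylinder has
one-dimensional Hausdorff measure zero — Tsai 1998 Lemma 4.2 and remark, after CKN; by-name addition
to row F9) — ALIAS of `tsai1998_top_singular_null`, PROVED.  EXCLUDED-IN-TREE ("fat" singular sets at
the first singular time excluded). (ref: Tsai1998, Lemma 4.2 and remark p. 46) -/
def Row_F9t : Prop := tsai1998_top_singular_null

/-- Row F9t is a theorem of the tree. [cite: Tsai1998, Lemma 4.2 and the following remark (p. 46)] -/
theorem row_F9t_excluded : Row_F9t := tsai1998_top_singular_null_holds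

/-- **Row F18eV** (localized hybrid criterion of Grujić–Guberović 2010 in its vorticity-magnitude form;
by-name addition to row F18 (e)) — ALIAS of `grujicGuberovic2010_localized_vorticity_criterion`,
PROVED.  EXCLUDED-IN-TREE (criterion). (ref: GrujicGuberovic2010) -/
def Row_F18eV : Prop := grujicGuberovic2010_localized_vorticity_criterion

/-- Row F18eV is a theorem of the tree. [cite: GrujicGuberovic2010, Thm 1] -/
theorem row_F18eV_excluded : Row_F18eV := grujicGuberovic2010_localized_vorticity_criterion_holds

/-! ## Row F0 ↔ F1 ∧ F4 (appended 2026-08-28; census §6 ask `row_F0_iff`) -/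

/-- **F0 ⇔ F1 ∧ F4**: no first-time singularity from smooth rapidly decaying data (the Leray–Hopf
frame form of Clay A, `Row_F0`) iff no Type-I blow-up (`Row_F1`) and no Type-II first blow-up
(`Row_F4`) — packaging the parent file's `row_F0_of_F1_F4`, `row_F1_of_F0`, `row_F4_of_F0`.
[folklore] -/
theorem row_F0_iff : Row_F0 ↔ Row_F1 ∧ Row_F4 :=
  ⟨fun h₀ => ⟨row_F1_of_F0 h₀, row_F4_of_F0 h₀⟩, fun h => row_F0_of_F1_F4 h.1 h.2⟩

end Summit.NavierStokesRegularity.NavierStokesRegularity.Theorems.ScenarioCensus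

end
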